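import Literature.Probability.Percolation.SlabRSWGluingFeeders
import HarnessLib

/-!
# Newman–Tassion–Wu 2017, §3.2 (Remark 2: rectilinear domains) — routes in a cross-shaped region

Topic: `Literature/Probability/Percolation`. The rerouting step of NTW's gluing lemma (Thm. 3.7,
steps (1)–(3); DST 2016, Fact 2: three disjoint paths) is in the tree for RECTANGLES
(`exists_route`). Near an inner corner of a rectilinear domain the cleared box meets the domain in
an `L`-shaped region; this file routes in the more general CROSS `Λ = A ∪ B` of a vertical bar
`A = [xL,xR] × [r₁,r₂]` and a horizontal bar `B = [c₁,c₂] × [rB,rT]` meeting in the block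
`[xL,xR] × [rB,rT]` (at least `3 × 4`): for any three terminals `E₁ ≠ E₂`, `w'` over `Λ` with the
branch end `w'` over a cell different from those of `E₁, E₂`, a route (`RouteSpec`) inside `Λ`
exists (`exists_route_cross`; the four `L`-shapes are the cases `r₁ = rB` or `r₂ = rT`, `c₁ = xL` or
`c₂ = xR`). Proof: two of the three terminals lie in one bar; route there (`exists_route`) and bring
the third in along a FEEDER chain inside the other bar (`exists_feeder_col`, `exists_feeder_row`;
`RouteSpec.prepend_trunk` / `append_trunk` / `append_branch`).

## Sources

* C. M. Newman, V. Tassion, W. Wu, *Critical percolation and the minimal spanning tree in slabs*,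
  Comm. Pure Appl. Math. 70 (2017), arXiv:1512.09107: §3.2, proof of Theorem 3.7, steps (1)–(3),
  and Remark 2 after Theorem 3.7 ("the proof also applies if … rectilinear domain")
  [NewmanTassionWu2017].
* H. Duminil-Copin, V. Sidoravicius, V. Tassion, CPAM 69 (2016), §2.3, proof of Fact 2
  [DuminilCopinSidoraviciusTassion2016].
-/

noncomputable section

namespace Literature.Probability.Percolation

open LatticeModels SimpleGraph

namespace NTW17

variable {k : ℕ}

/-! ## Feeder chains -/

/-- A free target among three candidates avoiding two forbidden values. [folklore] -/
private theorem exists_free_of_three {a : ℤ} (f₁ f₂ : ℤ) : ∃ x, a ≤ x ∧ x ≤ a + 2 ∧ x ≠ f₁ ∧ x ≠ f₂ := by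
  by_cases h0 : a ≠ f₁ ∧ a ≠ f₂
  · exact ⟨a, le_rfl, by omega, h0.1, h0.2⟩
  by_cases h1 : a + 1 ≠ f₁ ∧ a + 1 ≠ f₂
  · exact ⟨a + 1, by omega, by omega, h1.1, h1.2⟩
  refine ⟨a + 2, by omega, le_rfl, ?_, ?_⟩ <;> omega

/-- The lift of a planar `PPath` at height `h ≤ k`, extended by one more lattice step to a vertex off
the path, is a slab path; membership. [folklore] -/
private theorem feeder_of_ppath {l : List (ℤ × ℤ)} {s m : ℤ × ℤ} (hl : PPath l s m) {h : ℕ} (hh : h ≤ k)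
    {e : ℤ × ℤ} (hadj : planarAdj m e) (he : e ∉ l) :
    SPath (liftH k h l ++ [vtx k e h]) (vtx k s h) (vtx k e h) ∧
      ∀ v ∈ liftH k h l ++ [vtx k e h], v ≠ vtx k e h → planar k v ∈ l := by
  have hX := liftH_spath (k := k) hl h
  have heX : vtx k e h ∉ liftH k h l := by
    intro hm
    rw [mem_liftH_iff hh] at hm
    rw [planar_vtx] at hm
    exact he hm.1
  refine ⟨hX.concat (vtx_adj_vtx_planar hadj h) heX, fun v hv hne => ?_⟩
  rcases List.mem_append.1 hv with hv | hv
  · rw [mem_liftH_iff hh] at hv; exact hv.1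
  · exact absurd (List.mem_singleton.1 hv) hne

/-- **Feeder along a column.** A terminal `t` over the vertical bar `A = [xL,xR] × [r₁,r₂]` but off
the rows `[rB,rT]` of the block (`xL + 2 ≤ xR`) is joined, inside `A` and off those rows, by a
self-avoiding lattice chain at its own height to a vertex `e` over the block's boundary row, whose
cell avoids two prescribed cells. [cite: NewmanTassionWu2017, §3.2 (proof of Theorem 3.7, step (3); Remark 2)] -/
theorem exists_feeder_col {xL xR rB rT r₁ r₂ : ℤ} (hcols : xL + 2 ≤ xR) (hr₁ : r₁ ≤ rB) (hr₂ : rT ≤ r₂)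
    (hrows : rB ≤ rT) {t : slab 3 k} (htA : planar k t ∈ boxR xL xR r₁ r₂)
    (htB : (planar k t).2 < rB ∨ rT < (planar k t).2) (f₁ f₂ : ℤ × ℤ) :
    ∃ (F : List (slab 3 k)) (e : slab 3 k), SPath F t e ∧ t ≠ e ∧ ht e = ht t ∧
      planar k e ∈ boxR xL xR rB rT ∧ planar k e ≠ f₁ ∧ planar k e ≠ f₂ ∧
      ∀ v ∈ F, v ≠ e → planar k v ∈ boxR xL xR r₁ r₂ ∧ ((planar k v).2 < rB ∨ rT < (planar k v).2) := by
  rw [mem_boxR_iff] at htA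
  set x := (planar k t).1 with hx
  set y := (planar k t).2 with hy
  have hpt : planar k t = (x, y) := by ext <;> rfl
  rcases htB with hlow | hhigh
  · -- `t` below the block: climb to the row `rB - 1`, shift to a free column, enter at row `rB`
    obtain ⟨xs, hxs1, hxs2, hf₁, hf₂⟩ := exists_free_of_three (a := xL)
      (if f₁.2 = rB then f₁.1 else xL - 1) (if f₂.2 = rB then f₂.1 else xL - 1)
    obtain ⟨l, hl, hlmem⟩ := exists_lpath_vh (x, y) (xs, rB - 1)
    have he : ((xs, rB) : ℤ × ℤ) ∉ l := by
      intro h; rcases (hlmem _).1 h with ⟨-, -, h3⟩ | ⟨h1, -, -⟩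
      · simp only at h3; rw [max_def] at h3; split_ifs at h3 <;> omega
      · simp only at h1; omega
    obtain ⟨hF, hmem⟩ := feeder_of_ppath (k := k) hl (ht_le t) (e := (xs, rB)) (Or.inr (Or.inl (by ext <;> simp))) he
    rw [← hpt, vtx_planar_ht] at hF
    refine ⟨_, _, hF, ?_, ht_vtx (ht_le t) _, ?_, ?_, ?_, fun v hv hne => ?_⟩
    · intro h; have := congrArg (fun v => (planar k v).2) h; simp only [planar_vtx] at this; omega
    · rw [planar_vtx, mem_boxR_iff]; simp only; omega
    · rw [planar_vtx]; intro h; rw [← h] at hf₁; simp at hf₁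
    · rw [planar_vtx]; intro h; rw [← h] at hf₂; simp at hf₂
    · have := hmem v hv hne
      rcases (hlmem _).1 this with ⟨h1, h2, h3⟩ | ⟨h1, h2, h3⟩ <;> simp only at h1 h2 h3 <;>
        rw [min_def] at h2 <;> rw [max_def] at h3 <;> rw [mem_boxR_iff] <;> split_ifs at h2 h3 <;> omega
  · -- `t` above the block: descend to the row `rT + 1`, shift, enter at row `rT`
    obtain ⟨xs, hxs1, hxs2, hf₁, hf₂⟩ := exists_free_of_three (a := xL)
      (if f₁.2 = rT then f₁.1 else xL - 1) (if f₂.2 = rT then f₂.1 else xL - 1)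
    obtain ⟨l, hl, hlmem⟩ := exists_lpath_vh (x, y) (xs, rT + 1)
    have he : ((xs, rT) : ℤ × ℤ) ∉ l := by
      intro h; rcases (hlmem _).1 h with ⟨-, h2, -⟩ | ⟨h1, -, -⟩
      · simp only at h2; rw [min_def] at h2; split_ifs at h2 <;> omega
      · simp only at h1; omega
    obtain ⟨hF, hmem⟩ := feeder_of_ppath (k := k) hl (ht_le t) (e := (xs, rT))
      (Or.inr (Or.inr (by ext <;> simp))) he
    rw [← hpt, vtx_planar_ht] at hF
    refine ⟨_, _, hF, ?_, ht_vtx (ht_le t) _, ?_, ?_, ?_, fun v hv hne => ?_⟩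
    · intro h; have := congrArg (fun v => (planar k v).2) h; simp only [planar_vtx] at this; omega
    · rw [planar_vtx, mem_boxR_iff]; simp only; omega
    · rw [planar_vtx]; intro h; rw [← h] at hf₁; simp at hf₁
    · rw [planar_vtx]; intro h; rw [← h] at hf₂; simp at hf₂
    · have := hmem v hv hne
      rcases (hlmem _).1 this with ⟨h1, h2, h3⟩ | ⟨h1, h2, h3⟩ <;> simp only at h1 h2 h3 <;>
        rw [min_def] at h2 <;> rw [max_def] at h3 <;> rw [mem_boxR_iff] <;> split_ifs at h2 h3 <;> omega

/-- **Feeder along a row.** A terminal `t` over the horizontal bar `B = [c₁,c₂] × [rB,rT]` but off the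
columns `[xL,xR]` of the block (`rB + 2 ≤ rT`) is joined, inside `B` and off those columns, by a
self-avoiding lattice chain at its own height to a vertex `e` over the block's boundary column,
whose cell avoids two prescribed cells. [cite: NewmanTassionWu2017, §3.2 (proof of Theorem 3.7, step (3); Remark 2)] -/
theorem exists_feeder_row {xL xR rB rT c₁ c₂ : ℤ} (hrows : rB + 2 ≤ rT) (hc₁ : c₁ ≤ xL) (hc₂ : xR ≤ c₂)
    (hcols : xL ≤ xR) {t : slab 3 k} (htB : planar k t ∈ boxR c₁ c₂ rB rT)
    (htA : (planar k t).1 < xL ∨ xR < (planar k t).1) (f₁ f₂ : ℤ × ℤ) :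
    ∃ (F : List (slab 3 k)) (e : slab 3 k), SPath F t e ∧ t ≠ e ∧ ht e = ht t ∧
      planar k e ∈ boxR xL xR rB rT ∧ planar k e ≠ f₁ ∧ planar k e ≠ f₂ ∧
      ∀ v ∈ F, v ≠ e → planar k v ∈ boxR c₁ c₂ rB rT ∧ ((planar k v).1 < xL ∨ xR < (planar k v).1) := by
  rw [mem_boxR_iff] at htB
  set x := (planar k t).1 with hx
  set y := (planar k t).2 with hy
  have hpt : planar k t = (x, y) := by ext <;> rfl
  rcases htA with hleft | hright
  · -- `t` left of the block: go right to the column `xL - 1`, shift to a free row, enter at column `xL`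
    obtain ⟨ys, hys1, hys2, hf₁, hf₂⟩ := exists_free_of_three (a := rB)
      (if f₁.1 = xL then f₁.2 else rB - 1) (if f₂.1 = xL then f₂.2 else rB - 1)
    obtain ⟨l, hl, hlmem⟩ := exists_lpath_hv (x, y) (xL - 1, ys)
    have he : ((xL, ys) : ℤ × ℤ) ∉ l := by
      intro h; rcases (hlmem _).1 h with ⟨-, -, h3⟩ | ⟨h1, -, -⟩
      · simp only at h3; rw [max_def] at h3; split_ifs at h3 <;> omega
      · simp only at h1; omega
    obtain ⟨hF, hmem⟩ := feeder_of_ppath (k := k) hl (ht_le t) (e := (xL, ys))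
      (Or.inl (Or.inl (by ext <;> simp))) he
    rw [← hpt, vtx_planar_ht] at hF
    refine ⟨_, _, hF, ?_, ht_vtx (ht_le t) _, ?_, ?_, ?_, fun v hv hne => ?_⟩
    · intro h; have := congrArg (fun v => (planar k v).1) h; simp only [planar_vtx] at this; omega
    · rw [planar_vtx, mem_boxR_iff]; simp only; omega
    · rw [planar_vtx]; intro h; rw [← h] at hf₁; simp at hf₁
    · rw [planar_vtx]; intro h; rw [← h] at hf₂; simp at hf₂
    · have := hmem v hv hne
      rcases (hlmem _).1 this with ⟨h1, h2, h3⟩ | ⟨h1, h2, h3⟩ <;> simp only at h1 h2 h3 <;>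
        rw [min_def] at h2 <;> rw [max_def] at h3 <;> rw [mem_boxR_iff] <;> split_ifs at h2 h3 <;> omega
  · -- `t` right of the block: go left to the column `xR + 1`, shift, enter at column `xR`
    obtain ⟨ys, hys1, hys2, hf₁, hf₂⟩ := exists_free_of_three (a := rB)
      (if f₁.1 = xR then f₁.2 else rB - 1) (if f₂.1 = xR then f₂.2 else rB - 1)
    obtain ⟨l, hl, hlmem⟩ := exists_lpath_hv (x, y) (xR + 1, ys)
    have he : ((xR, ys) : ℤ × ℤ) ∉ l := by
      intro h; rcases (hlmem _).1 h with ⟨-, h2, -⟩ | ⟨h1, -, -⟩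
      · simp only at h2; rw [min_def] at h2; split_ifs at h2 <;> omega
      · simp only at h1; omega
    obtain ⟨hF, hmem⟩ := feeder_of_ppath (k := k) hl (ht_le t) (e := (xR, ys))
      (Or.inl (Or.inr (by ext <;> simp))) he
    rw [← hpt, vtx_planar_ht] at hF
    refine ⟨_, _, hF, ?_, ht_vtx (ht_le t) _, ?_, ?_, ?_, fun v hv hne => ?_⟩
    · intro h; have := congrArg (fun v => (planar k v).1) h; simp only [planar_vtx] at this; omega
    · rw [planar_vtx, mem_boxR_iff]; simp only; omega
    · rw [planar_vtx]; intro h; rw [← h] at hf₁; simp at hf₁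
    · rw [planar_vtx]; intro h; rw [← h] at hf₂; simp at hf₂
    · have := hmem v hv hne
      rcases (hlmem _).1 this with ⟨h1, h2, h3⟩ | ⟨h1, h2, h3⟩ <;> simp only at h1 h2 h3 <;>
        rw [min_def] at h2 <;> rw [max_def] at h3 <;> rw [mem_boxR_iff] <;> split_ifs at h2 h3 <;> omega

/-! ## Routes in the cross -/

section Cross

variable {xL xR rB rT r₁ r₂ c₁ c₂ : ℤ}

/-- Splitting a feeder `F = X ++ [e]` (forward form) and `F.reverse = e :: X.reverse` (backward form).
[folklore] -/
private theorem feeder_split {F : List (slab 3 k)} {t e : slab 3 k} (hF : SPath F t e) (hte : t ≠ e) :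
    ∃ X : List (slab 3 k), X ≠ [] ∧ F = X ++ [e] ∧ (∀ x ∈ X, x ∈ F ∧ x ≠ e) ∧ X.Nodup ∧
      (∃ hX : X ≠ [], X.head hX = t) ∧ (X ++ [e]).IsChain (fun a b => (slabGraph 3 k).Adj a b) ∧
      (e :: X.reverse).IsChain (fun a b => (slabGraph 3 k).Adj a b) ∧
      (∃ hX : X.reverse ≠ [], X.reverse.getLast hX = t) := by
  obtain ⟨X, hFX⟩ := exists_eq_append_of_getLast? hF.last
  have hX : X ≠ [] := by
    rintro rfl
    have := hF.head
    rw [hFX] at this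
    simp only [List.nil_append, List.head?_cons, Option.some.injEq] at this
    exact hte this.symm
  have hnd : (X ++ [e]).Nodup := hFX ▸ hF.nodup
  have hdisj := List.disjoint_of_nodup_append hnd
  have hXhead : X.head hX = t := by
    have := hF.head
    rw [hFX, List.head?_append_of_ne_nil _ hX, List.head?_eq_some_head hX, Option.some.injEq] at this
    exact this
  refine ⟨X, hX, hFX, fun x hx => ⟨hFX ▸ List.mem_append_left _ hx, fun h => hdisj hx (by simp [h])⟩,
    hnd.of_append_left, ⟨hX, hXhead⟩, hFX ▸ hF.chain, ?_, ⟨by simpa using hX, by rw [List.getLast_reverse]; exact hXhead⟩⟩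
  have := hF.reverse.chain
  rw [hFX, List.reverse_append] at this
  simpa using this

/-- **Routing in a cross.** Let `A = [xL,xR] × [r₁,r₂]` and `B = [c₁,c₂] × [rB,rT]` be two bars
meeting in the block `[xL,xR] × [rB,rT]` with at least three columns and four rows
(`r₁ ≤ rB`, `rT ≤ r₂`, `c₁ ≤ xL`, `xR ≤ c₂`; `k ≥ 1`). For distinct vertices `E₁, E₂` and a vertex
`w'` over `A ∪ B` whose cell differs from those of `E₁, E₂`, there is a route in `A ∪ B` (trunk from
`E₁` to `E₂`, branch to `w'`, forward condition). The `L`-shaped regions of NTW's rectilinear domains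
are the cases where one arm of the cross is absent.
[cite: NewmanTassionWu2017, §3.2 (proof of Theorem 3.7, steps (1)–(3); Remark 2)] -/
theorem exists_route_cross (hk : 1 ≤ k) (hcols : xL + 2 ≤ xR) (hrows : rB + 3 ≤ rT)
    (hr₁ : r₁ ≤ rB) (hr₂ : rT ≤ r₂) (hc₁ : c₁ ≤ xL) (hc₂ : xR ≤ c₂) {E₁ E₂ w' : slab 3 k}
    (hE₁ : planar k E₁ ∈ boxR xL xR r₁ r₂ ∪ boxR c₁ c₂ rB rT)
    (hE₂ : planar k E₂ ∈ boxR xL xR r₁ r₂ ∪ boxR c₁ c₂ rB rT)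
    (hw' : planar k w' ∈ boxR xL xR r₁ r₂ ∪ boxR c₁ c₂ rB rT)
    (hne : E₁ ≠ E₂) (had : planar k E₁ ≠ planar k w') (hbd : planar k E₂ ≠ planar k w') :
    ∃ L Br c, RouteSpec k (boxR xL xR r₁ r₂ ∪ boxR c₁ c₂ rB rT) (boxR xL xR r₁ r₂ ∪ boxR c₁ c₂ rB rT)
      E₁ E₂ w' L Br c := by
  set A := boxR xL xR r₁ r₂ with hA
  set B := boxR c₁ c₂ rB rT with hB
  have hAΛ : A ⊆ A ∪ B := Set.subset_union_left
  have hBΛ : B ⊆ A ∪ B := Set.subset_union_right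
  have hTB : boxR xL xR rB rT ⊆ B := fun z hz => by rw [mem_boxR_iff] at hz; rw [hB, mem_boxR_iff]; omega
  have hTA : boxR xL xR rB rT ⊆ A := fun z hz => by rw [mem_boxR_iff] at hz; rw [hA, mem_boxR_iff]; omega
  -- dichotomies: a terminal off `B` is over `A` above or below the block, and symmetrically
  have offB : ∀ {t : slab 3 k}, planar k t ∈ A ∪ B → planar k t ∉ B →
      planar k t ∈ A ∧ ((planar k t).2 < rB ∨ rT < (planar k t).2) := by
    intro t ht htB
    rcases ht with ht | ht
    · refine ⟨ht, ?_⟩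
      rw [hA, mem_boxR_iff] at ht; rw [hB, mem_boxR_iff] at htB; omega
    · exact absurd ht htB
  have offA : ∀ {t : slab 3 k}, planar k t ∈ A ∪ B → planar k t ∉ A →
      planar k t ∈ B ∧ ((planar k t).1 < xL ∨ xR < (planar k t).1) := by
    intro t ht htA
    rcases ht with ht | ht
    · exact absurd ht htA
    · refine ⟨ht, ?_⟩
      rw [hB, mem_boxR_iff] at ht; rw [hA, mem_boxR_iff] at htA; omega
  -- routing inside one bar
  have routeB : ∀ {a b w : slab 3 k}, planar k a ∈ B → planar k b ∈ B → planar k w ∈ B → a ≠ b →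
      planar k a ≠ planar k w → planar k b ≠ planar k w → ∃ L Br c, RouteSpec k B B a b w L Br c :=
    fun ha hb hw hab haw hbw => exists_route hk (by omega) le_rfl hrows le_rfl ha hb hw hab haw hbw
  have routeA : ∀ {a b w : slab 3 k}, planar k a ∈ A → planar k b ∈ A → planar k w ∈ A → a ≠ b →
      planar k a ≠ planar k w → planar k b ≠ planar k w → ∃ L Br c, RouteSpec k A A a b w L Br c :=
    fun ha hb hw hab haw hbw => exists_route hk hcols le_rfl (by omega) le_rfl ha hb hw hab haw hbw
  -- lists over a bar miss vertices off it
  have missB : ∀ {L : List (slab 3 k)} {x : slab 3 k}, (∀ v ∈ L, planar k v ∈ B) →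
      ((planar k x).2 < rB ∨ rT < (planar k x).2) → x ∉ L := by
    intro L x hL hx hm; have := hL x hm; rw [hB, mem_boxR_iff] at this; omega
  have missA : ∀ {L : List (slab 3 k)} {x : slab 3 k}, (∀ v ∈ L, planar k v ∈ A) →
      ((planar k x).1 < xL ∨ xR < (planar k x).1) → x ∉ L := by
    intro L x hL hx hm; have := hL x hm; rw [hA, mem_boxR_iff] at this; omega
  /- the six feeding blocks -/
  -- feed `E₁` into a route in `B`
  have feedE₁B : planar k E₁ ∉ B → planar k E₂ ∈ B → planar k w' ∈ B →
      ∃ L Br c, RouteSpec k (A ∪ B) (A ∪ B) E₁ E₂ w' L Br c := by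
    intro h1 h2 h3
    obtain ⟨h1A, h1out⟩ := offB hE₁ h1
    obtain ⟨F, e, hF, hte, -, heT, hef₁, hef₂, hout⟩ :=
      exists_feeder_col hcols hr₁ hr₂ (by omega) h1A h1out (planar k E₂) (planar k w')
    obtain ⟨L', Br', c, spec⟩ := routeB (hTB heT) h2 h3 (fun h => hef₁ (by rw [h])) hef₂ hbd
    obtain ⟨X, hX, hFX, hXF, hXnd, ⟨hX', hXhead⟩, hch, -, -⟩ := feeder_split hF hte
    have res := RouteSpec.prepend_trunk hBΛ X e L' hX spec hch hXnd
      (fun x hx => missB spec.hL_sub (hout x (hXF x hx).1 (hXF x hx).2).2)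
      (fun x hx => missB spec.hBr_sub (hout x (hXF x hx).1 (hXF x hx).2).2)
      (fun x hx => hAΛ (hout x (hXF x hx).1 (hXF x hx).2).1)
    rw [hXhead] at res
    exact ⟨_, _, _, RouteSpec.mono res subset_rfl hBΛ⟩
  -- feed `E₂` into a route in `B`
  have feedE₂B : planar k E₁ ∈ B → planar k E₂ ∉ B → planar k w' ∈ B →
      ∃ L Br c, RouteSpec k (A ∪ B) (A ∪ B) E₁ E₂ w' L Br c := by
    intro h1 h2 h3
    obtain ⟨h2A, h2out⟩ := offB hE₂ h2
    obtain ⟨F, e, hF, hte, -, heT, hef₁, hef₂, hout⟩ :=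
      exists_feeder_col hcols hr₁ hr₂ (by omega) h2A h2out (planar k E₁) (planar k w')
    obtain ⟨L', Br', c, spec⟩ := routeB h1 (hTB heT) h3 (fun h => hef₁ (by rw [h])) had hef₂
    obtain ⟨X, hX, hFX, hXF, hXnd, -, -, hchr, ⟨hXr, hXlast⟩⟩ := feeder_split hF hte
    have res := RouteSpec.append_trunk hBΛ X.reverse e L' hXr spec hchr (List.nodup_reverse.2 hXnd)
      (fun x hx => missB spec.hL_sub (hout x (hXF x (List.mem_reverse.1 hx)).1 (hXF x (List.mem_reverse.1 hx)).2).2)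
      (fun x hx => missB spec.hBr_sub (hout x (hXF x (List.mem_reverse.1 hx)).1 (hXF x (List.mem_reverse.1 hx)).2).2)
      (fun x hx => hAΛ (hout x (hXF x (List.mem_reverse.1 hx)).1 (hXF x (List.mem_reverse.1 hx)).2).1)
    rw [hXlast] at res
    exact ⟨_, _, _, RouteSpec.mono res subset_rfl hBΛ⟩
  -- feed `w'` into a route in `B`
  have feedWB : planar k E₁ ∈ B → planar k E₂ ∈ B → planar k w' ∉ B →
      ∃ L Br c, RouteSpec k (A ∪ B) (A ∪ B) E₁ E₂ w' L Br c := by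
    intro h1 h2 h3
    obtain ⟨h3A, h3out⟩ := offB hw' h3
    obtain ⟨F, e, hF, hte, -, heT, hef₁, hef₂, hout⟩ :=
      exists_feeder_col hcols hr₁ hr₂ (by omega) h3A h3out (planar k E₁) (planar k E₂)
    obtain ⟨L', Br', c, spec⟩ := routeB h1 h2 (hTB heT) hne (fun h => hef₁ h.symm) (fun h => hef₂ h.symm)
    obtain ⟨X, hX, hFX, hXF, hXnd, -, -, hchr, ⟨hXr, hXlast⟩⟩ := feeder_split hF hte
    have spec' := RouteSpec.mono spec subset_rfl hBΛ
    have res := RouteSpec.append_branch X.reverse e Br' hXr spec' hchr (List.nodup_reverse.2 hXnd)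
      (fun x hx => missB spec.hL_sub (hout x (hXF x (List.mem_reverse.1 hx)).1 (hXF x (List.mem_reverse.1 hx)).2).2)
      (fun x hx hm => by
        rcases List.mem_cons.1 hm with hm | hm
        · exact missB spec.hL_sub (hout x (hXF x (List.mem_reverse.1 hx)).1 (hXF x (List.mem_reverse.1 hx)).2).2
            (hm ▸ spec.hc)
        · exact missB spec.hBr_sub (hout x (hXF x (List.mem_reverse.1 hx)).1 (hXF x (List.mem_reverse.1 hx)).2).2 hm)
      (fun x hx => hAΛ (hout x (hXF x (List.mem_reverse.1 hx)).1 (hXF x (List.mem_reverse.1 hx)).2).1)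
    rw [hXlast] at res
    exact ⟨_, _, _, RouteSpec.mono res hBΛ subset_rfl⟩
  -- feed `E₁` into a route in `A`
  have feedE₁A : planar k E₁ ∉ A → planar k E₂ ∈ A → planar k w' ∈ A →
      ∃ L Br c, RouteSpec k (A ∪ B) (A ∪ B) E₁ E₂ w' L Br c := by
    intro h1 h2 h3
    obtain ⟨h1B, h1out⟩ := offA hE₁ h1
    obtain ⟨F, e, hF, hte, -, heT, hef₁, hef₂, hout⟩ :=
      exists_feeder_row (by omega) hc₁ hc₂ (by omega) h1B h1out (planar k E₂) (planar k w')
    obtain ⟨L', Br', c, spec⟩ := routeA (hTA heT) h2 h3 (fun h => hef₁ (by rw [h])) hef₂ hbd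
    obtain ⟨X, hX, hFX, hXF, hXnd, ⟨hX', hXhead⟩, hch, -, -⟩ := feeder_split hF hte
    have res := RouteSpec.prepend_trunk hAΛ X e L' hX spec hch hXnd
      (fun x hx => missA spec.hL_sub (hout x (hXF x hx).1 (hXF x hx).2).2)
      (fun x hx => missA spec.hBr_sub (hout x (hXF x hx).1 (hXF x hx).2).2)
      (fun x hx => hBΛ (hout x (hXF x hx).1 (hXF x hx).2).1)
    rw [hXhead] at res
    exact ⟨_, _, _, RouteSpec.mono res subset_rfl hAΛ⟩
  -- feed `E₂` into a route in `A`
  have feedE₂A : planar k E₁ ∈ A → planar k E₂ ∉ A → planar k w' ∈ A →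
      ∃ L Br c, RouteSpec k (A ∪ B) (A ∪ B) E₁ E₂ w' L Br c := by
    intro h1 h2 h3
    obtain ⟨h2B, h2out⟩ := offA hE₂ h2
    obtain ⟨F, e, hF, hte, -, heT, hef₁, hef₂, hout⟩ :=
      exists_feeder_row (by omega) hc₁ hc₂ (by omega) h2B h2out (planar k E₁) (planar k w')
    obtain ⟨L', Br', c, spec⟩ := routeA h1 (hTA heT) h3 (fun h => hef₁ (by rw [h])) had hef₂
    obtain ⟨X, hX, hFX, hXF, hXnd, -, -, hchr, ⟨hXr, hXlast⟩⟩ := feeder_split hF hte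
    have res := RouteSpec.append_trunk hAΛ X.reverse e L' hXr spec hchr (List.nodup_reverse.2 hXnd)
      (fun x hx => missA spec.hL_sub (hout x (hXF x (List.mem_reverse.1 hx)).1 (hXF x (List.mem_reverse.1 hx)).2).2)
      (fun x hx => missA spec.hBr_sub (hout x (hXF x (List.mem_reverse.1 hx)).1 (hXF x (List.mem_reverse.1 hx)).2).2)
      (fun x hx => hBΛ (hout x (hXF x (List.mem_reverse.1 hx)).1 (hXF x (List.mem_reverse.1 hx)).2).1)
    rw [hXlast] at res
    exact ⟨_, _, _, RouteSpec.mono res subset_rfl hAΛ⟩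
  -- feed `w'` into a route in `A`
  have feedWA : planar k E₁ ∈ A → planar k E₂ ∈ A → planar k w' ∉ A →
      ∃ L Br c, RouteSpec k (A ∪ B) (A ∪ B) E₁ E₂ w' L Br c := by
    intro h1 h2 h3
    obtain ⟨h3B, h3out⟩ := offA hw' h3
    obtain ⟨F, e, hF, hte, -, heT, hef₁, hef₂, hout⟩ :=
      exists_feeder_row (by omega) hc₁ hc₂ (by omega) h3B h3out (planar k E₁) (planar k E₂)
    obtain ⟨L', Br', c, spec⟩ := routeA h1 h2 (hTA heT) hne (fun h => hef₁ h.symm) (fun h => hef₂ h.symm)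
    obtain ⟨X, hX, hFX, hXF, hXnd, -, -, hchr, ⟨hXr, hXlast⟩⟩ := feeder_split hF hte
    have spec' := RouteSpec.mono spec subset_rfl hAΛ
    have res := RouteSpec.append_branch X.reverse e Br' hXr spec' hchr (List.nodup_reverse.2 hXnd)
      (fun x hx => missA spec.hL_sub (hout x (hXF x (List.mem_reverse.1 hx)).1 (hXF x (List.mem_reverse.1 hx)).2).2)
      (fun x hx hm => by
        rcases List.mem_cons.1 hm with hm | hm
        · exact missA spec.hL_sub (hout x (hXF x (List.mem_reverse.1 hx)).1 (hXF x (List.mem_reverse.1 hx)).2).2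
            (hm ▸ spec.hc)
        · exact missA spec.hBr_sub (hout x (hXF x (List.mem_reverse.1 hx)).1 (hXF x (List.mem_reverse.1 hx)).2).2 hm)
      (fun x hx => hBΛ (hout x (hXF x (List.mem_reverse.1 hx)).1 (hXF x (List.mem_reverse.1 hx)).2).1)
    rw [hXlast] at res
    exact ⟨_, _, _, RouteSpec.mono res hAΛ subset_rfl⟩
  /- the case analysis -/
  by_cases hallB : planar k E₁ ∈ B ∧ planar k E₂ ∈ B ∧ planar k w' ∈ B
  · obtain ⟨L, Br, c, spec⟩ := routeB hallB.1 hallB.2.1 hallB.2.2 hne had hbd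
    exact ⟨L, Br, c, RouteSpec.mono spec hBΛ hBΛ⟩
  by_cases hallA : planar k E₁ ∈ A ∧ planar k E₂ ∈ A ∧ planar k w' ∈ A
  · obtain ⟨L, Br, c, spec⟩ := routeA hallA.1 hallA.2.1 hallA.2.2 hne had hbd
    exact ⟨L, Br, c, RouteSpec.mono spec hAΛ hAΛ⟩
  have memA : ∀ {t : slab 3 k}, planar k t ∈ A ∪ B → planar k t ∉ B → planar k t ∈ A :=
    fun ht htB => (offB ht htB).1
  have memB : ∀ {t : slab 3 k}, planar k t ∈ A ∪ B → planar k t ∉ A → planar k t ∈ B :=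
    fun ht htA => (offA ht htA).1
  by_cases b1 : planar k E₁ ∈ B
  · by_cases b2 : planar k E₂ ∈ B
    · exact feedWB b1 b2 (fun b3 => hallB ⟨b1, b2, b3⟩)
    · by_cases b3 : planar k w' ∈ B
      · exact feedE₂B b1 b2 b3
      · -- `E₂, w'` over `A` off `B`; `E₁` over `A` would put everything in `A`
        exact feedE₁A (fun a1 => hallA ⟨a1, memA hE₂ b2, memA hw' b3⟩) (memA hE₂ b2) (memA hw' b3)
  · by_cases b2 : planar k E₂ ∈ B
    · by_cases b3 : planar k w' ∈ B
      · exact feedE₁B b1 b2 b3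
      · exact feedE₂A (memA hE₁ b1) (fun a2 => hallA ⟨memA hE₁ b1, a2, memA hw' b3⟩) (memA hw' b3)
    · exact feedWA (memA hE₁ b1) (memA hE₂ b2) (fun a3 => hallA ⟨memA hE₁ b1, memA hE₂ b2, a3⟩)

end Cross

end NTW17

end Literature.Probability.Percolation

end
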